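import Summits.NavierStokesRegularity.NavierStokesRegularity.Theses.HardyPointSink
import Summits.NavierStokesRegularity.NavierStokesRegularity.Theorems.AxisymmetricExtremalityAxisymmetricKatoGlobalStubOffAxisBoundedOfLocalEnergy
import Summits.NavierStokesRegularity.NavierStokesRegularity.Theorems.HardyPointSinkHardyEnergyBoundAxisTransfer
import Literature.Analysis.FluidPDE.SereginEpsilonRegularityHolds
import Literature.Analysis.FluidPDE.LocalTypeI
import Literature.Analysis.FluidPDE.SuitableWeakRescaling
import Literature.Analysis.FluidPDE.ClassicalSuitable
import Literature.Analysis.FluidPDE.KatoLocalCovariance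
import HarnessLib

/-!
# Route HardyPointSink — crux `HardyEnergyBound` (item stmt-NavierStokesRegularity-7979):
# finite Hardy DISSIPATION at the centre makes the final time regular there

Support file (theorems only, `--supports stmt-NavierStokesRegularity-7979`; lead c6 of the crux
line, 2026-08-17).  The point-sink ledger of the route (landed: `Theorems.stub_hardyLedger_of`)
balances the local Hardy energy `H(x₀,t) = ∫ |v(t)|²/|x − x₀|` against the **Hardy dissipation**
`∫∫ |∇v|²/|x − x₀|`, the point sink `4πν ∫ |v(s,x₀)|² ds` and the cumulative head influx toward
`x₀`.  This file proves the regularity criterion that governs the dissipative side at a point of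
the FINAL time:

* `isBoundedNearTop_of_hardyDissipation_lt_top` — for a suitable weak solution `(u, p)`
  (viscosity `ν > 0`) on the strip `(0, T) × ℝ³`, `u` smooth inside, with local energy classes
  reaching the final time (the frame of `AxisymmetricKatoGlobal.Registered.stub_katoLocalEnergyNearTop`),
  and a centre `x₀` at which the Hardy-weighted dissipation is FINITE on one box,
  `∫∫_{(T−δ,T)×B(x₀,ρ₀)} |∇u|²/|x − x₀| < ∞`, the field `u` is bounded near `(T, x₀)`
  (`IsBoundedNearTop`).  Mechanism: along the viscosity-normalising zoom
  `v = (R/ν) u(T + (R²/ν)s, x₀ + Ry)` the CKN dissipation functional is dominated, at EVERY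
  scale `0 < r < 1`, by the Hardy dissipation of the physical cylinder,
  `E(r; v) = r⁻¹∫∫_{Q(0,r)}|∇v|² ≤ ν⁻¹ ∫∫_{(T−(Rr)²/ν,T)×B(x₀,Rr)} |∇u|²/|x − x₀|`
  (`r⁻¹ ≤ … ` is replaced by `(Rr)|x − x₀|⁻¹ ≥ 1` on `B(x₀,Rr)`; both functionals are scale
  invariant), and the right-hand side tends to `0` with the time window (continuity from above of
  a finite integral); Seregin's backward ε-regularity criterion (Seregin 2014, Ch. 6, Thm. 1.4,
  PROVED in the tree: `seregin2014_thm14_holds`) then bounds `v` near the vertex.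
* `hardyDissipation_eq_top_of_not_isBoundedNearTop` — contrapositive: at a point where `u` is
  unbounded near `(T, x₀)` the Hardy dissipation at the centre is INFINITE on every box
  `(T−δ, T) × B(x₀, ρ₀)`.

This is the dissipative half of the route's slogan "a singularity must drink divergent head"
(`HardyPointSinkHardyEnergyBoundDivergentInflux.lean` turns it, through the landed ledger, into
the divergence of the cumulative head influx toward every singular point).  The zoom frame is the
one of `AxisymmetricKatoGlobal.Registered.offAxisBounded_of_localEnergy` (p147674), with the
rotation packing of the dissipation replaced by the Hardy domination at the centre; no named fact
is used.

References: L. Caffarelli, R. Kohn, L. Nirenberg, Comm. Pure Appl. Math. 35 (1982), Prop. 2 and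
§8 [CKN1982]; G. Seregin, *Lecture Notes on Regularity Theory for the Navier–Stokes Equations*
(2014), Ch. 6, Thm. 1.4 [Seregin2014]; F. Lin, Comm. Pure Appl. Math. 51 (1998), Thm. 1.1 [Lin1998].
-/

-- the problem directory repeats the summit name (D-0017); core's `dupNamespace` linter fires
set_option linter.dupNamespace false

noncomputable section

open Set MeasureTheory Filter Topology TopologicalSpace Function Metric Module
open scoped ENNReal NNReal
open Literature.Analysis.FluidPDE Literature.Analysis.FunctionSpaces

namespace Summit.NavierStokesRegularity.NavierStokesRegularity.Theorems

open AxisymmetricKatoGlobal.Registered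


/-! ### The Hardy-dissipation criterion at a point of the final time -/

/-- **Finite Hardy dissipation at the centre ⇒ the final time is regular there.**  For a suitable
weak solution `(u, p)` of the unforced Navier–Stokes equations (viscosity `ν > 0`) on the open
strip `(0, T) × ℝ³`, `u` smooth there, whose local energy classes reach the final time on every
`(t₁, T) × B_ρ(0)`, and a centre `x₀` with
`∫∫_{(T−δ,T)×B(x₀,ρ₀)} |∇u|²/|x − x₀| dx dt < ∞` for some `δ, ρ₀ > 0`, the field `u` is bounded on a
backward parabolic neighbourhood of `(T, x₀)`.  (Zoom about `(T, x₀)` to unit viscosity on the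
unit cylinder; `E(r; v) ≤ ν⁻¹ × (Hardy dissipation of the physical cylinder)` at every scale
`r < 1`; small time tails; Seregin 2014, Ch. 6, Thm. 1.4 = `seregin2014_thm14_holds`; transport
back.) [cite: Seregin2014, Ch. 6 §6.1 Theorem 1.4, PDF p. 94] -/
theorem isBoundedNearTop_of_hardyDissipation_lt_top {ν T : ℝ} (hν : 0 < ν) (hT : 0 < T)
    {u : ℝ → (EuclideanSpace ℝ (Fin 3)) → (EuclideanSpace ℝ (Fin 3))} {p : ℝ → (EuclideanSpace ℝ (Fin 3)) → ℝ} (hsm : ContDiffOn ℝ (⊤ : ℕ∞) (uncurry u) (Ioo 0 T ×ˢ univ))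
    (hsw : IsSuitableWeakSolutionOn (slab (EuclideanSpace ℝ (Fin 3)) (Ioo 0 T) isOpen_Ioo) ν 0 u p)
    (hloc : ∀ t₁ ∈ Ioo 0 T, ∀ ρ : ℝ, 0 < ρ →
      (∃ C : ℝ≥0, ∀ t ∈ Ioo t₁ T, ∫⁻ x in ball (0 : (EuclideanSpace ℝ (Fin 3))) ρ, ‖u t x‖ₑ ^ 2 ≤ C) ∧
      (∫⁻ z in Ioo t₁ T ×ˢ ball (0 : (EuclideanSpace ℝ (Fin 3))) ρ,
          ENNReal.ofReal (frobeniusNormSq (fderiv ℝ (u z.1) z.2)) < ∞) ∧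
      (∫⁻ z in Ioo t₁ T ×ˢ ball (0 : (EuclideanSpace ℝ (Fin 3))) ρ, ‖p z.1 z.2‖ₑ ^ (3 / 2 : ℝ) < ∞))
    (x₀ : (EuclideanSpace ℝ (Fin 3))) {δ ρ₀ : ℝ} (hδ : 0 < δ) (hρ₀ : 0 < ρ₀)
    (hW : ∫⁻ z in Ioo (T - δ) T ×ˢ ball x₀ ρ₀,
      ENNReal.ofReal (frobeniusNormSq (fderiv ℝ (u z.1) z.2)) / ‖z.2 - x₀‖ₑ < ∞) :
    IsBoundedNearTop u T x₀ := by
  obtain ⟨ε, hε, hcrit⟩ := seregin2014_thm14_holds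
  -- ### the local energy classes on `(T/2, T) × B(0, ϱ)`, `ϱ = ‖x₀‖ + ρ₀`
  set ϱ : ℝ := ‖x₀‖ + ρ₀ with hϱ
  obtain ⟨⟨C, hC⟩, hE, hP⟩ := hloc (T / 2) ⟨by linarith, by linarith⟩ ϱ (by positivity)
  have hballϱ : ∀ s : ℝ, s ≤ ρ₀ → ball x₀ s ⊆ ball (0 : (EuclideanSpace ℝ (Fin 3))) ϱ := by
    intro s hs x hx
    rw [mem_ball, dist_eq_norm] at hx
    rw [mem_ball_zero_iff, ← sub_add_cancel x x₀]
    exact (norm_add_le _ _).trans_lt (by rw [hϱ]; linarith)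
  have hhalf : Ioo (T / 2) T ×ˢ ball (0 : (EuclideanSpace ℝ (Fin 3))) ϱ ⊆ Ioo 0 T ×ˢ (univ : Set (EuclideanSpace ℝ (Fin 3))) :=
    prod_mono (Ioo_subset_Ioo_left (by linarith)) (subset_univ _)
  -- ### the cut-off Hardy-dissipation density: finite integral, small time tails
  set δ₁ : ℝ := min δ (T / 2) with hδ₁
  have hδ₁pos : 0 < δ₁ := lt_min hδ (by linarith)
  have hδ₁δ : δ₁ ≤ δ := min_le_left _ _
  have hδ₁T : δ₁ ≤ T / 2 := min_le_right _ _
  set S : Set (ℝ × (EuclideanSpace ℝ (Fin 3))) := Ioo (T - δ₁) T ×ˢ ball x₀ ρ₀ with hS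
  have hSmeas : MeasurableSet S := measurableSet_Ioo.prod measurableSet_ball
  set F : ℝ × (EuclideanSpace ℝ (Fin 3)) → ℝ≥0∞ := S.indicator
    (fun w : ℝ × (EuclideanSpace ℝ (Fin 3)) => ENNReal.ofReal (frobeniusNormSq (fderiv ℝ (u w.1) w.2)) / ‖w.2 - x₀‖ₑ)
    with hF
  have hFint : ∫⁻ z, F z ≠ ∞ := by
    rw [hF, lintegral_indicator hSmeas]
    refine ne_top_of_le_ne_top hW.ne (lintegral_mono_set ?_)
    exact prod_mono (Ioo_subset_Ioo_left (by linarith)) subset_rfl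
  obtain ⟨τ₀, hτ₀, -, hDτ₀⟩ := exists_time_tail_lt_of_lintegral_ne_top hFint hT
    (δ := ENNReal.ofReal (ε * ν)) (ENNReal.ofReal_pos.2 (by positivity))
  -- ### scales: `0 < R ≤ ρ₀`, `R²/ν ≤ δ₁ ≤ T/2`, `R²/ν ≤ τ₀`; `α = R/ν`, `β = R²/ν`
  set R : ℝ := min (min ρ₀ (Real.sqrt (ν * δ₁))) (Real.sqrt (ν * τ₀)) with hR
  have hRpos : 0 < R :=
    lt_min (lt_min hρ₀ (Real.sqrt_pos.2 (by positivity))) (Real.sqrt_pos.2 (by positivity))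
  have hRρ₀ : R ≤ ρ₀ := (min_le_left _ _).trans (min_le_left _ _)
  have hRτ : R ^ 2 / ν ≤ τ₀ := by
    have h2 := pow_le_pow_left₀ hRpos.le (min_le_right _ _ : R ≤ Real.sqrt (ν * τ₀)) 2
    rw [Real.sq_sqrt (by positivity)] at h2
    rw [div_le_iff₀ hν]
    linarith
  have hRδ₁ : R ^ 2 / ν ≤ δ₁ := by
    have h2 := pow_le_pow_left₀ hRpos.le ((min_le_left _ _).trans (min_le_right _ _) :
      R ≤ Real.sqrt (ν * δ₁)) 2
    rw [Real.sq_sqrt (by positivity)] at h2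
    rw [div_le_iff₀ hν]
    linarith
  set α : ℝ := R / ν with hα
  set β : ℝ := R ^ 2 / ν with hβdef
  have hαpos : 0 < α := by positivity
  have hβpos : 0 < β := by positivity
  have hβeq : β = α * R := by rw [hβdef, hα]; field_simp
  -- the `ν`-cylinders `(T - (Rr)²/ν, T) × B(x₀, Rr)`, `0 < r ≤ 1`: inside `S` and inside
  -- `(T/2,T) × B(0,ϱ)`; they are `Φ(Q(0, r))`
  have hνcylδ : ∀ r : ℝ, 0 < r → r ≤ 1 → (R * r) ^ 2 / ν ≤ δ₁ := fun r hr hr1 =>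
    le_trans (div_le_div_of_nonneg_right
      (pow_le_pow_left₀ (by positivity) (mul_le_of_le_one_right hRpos.le hr1) 2) hν.le) hRδ₁
  have hνcylT : ∀ r : ℝ, 0 < r → r ≤ 1 → (R * r) ^ 2 / ν ≤ T / 2 := fun r hr hr1 =>
    (hνcylδ r hr hr1).trans hδ₁T
  have hνcylS : ∀ r : ℝ, 0 < r → r ≤ 1 →
      Ioo (T - (R * r) ^ 2 / ν) T ×ˢ ball x₀ (R * r) ⊆ S := by
    intro r hr hr1
    have h1 := hνcylδ r hr hr1
    exact prod_mono (Ioo_subset_Ioo_left (by linarith))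
      (ball_subset_ball ((mul_le_of_le_one_right hRpos.le hr1).trans hRρ₀))
  have hνcyl : ∀ r : ℝ, 0 < r → r ≤ 1 →
      Ioo (T - (R * r) ^ 2 / ν) T ×ˢ ball x₀ (R * r) ⊆ Ioo (T / 2) T ×ˢ ball (0 : (EuclideanSpace ℝ (Fin 3))) ϱ := by
    intro r hr hr1
    have h1 := hνcylT r hr hr1
    exact prod_mono (Ioo_subset_Ioo_left (by linarith))
      (hballϱ _ ((mul_le_of_le_one_right hRpos.le hr1).trans hRρ₀))
  have hpreim : ∀ r : ℝ, parabolicCylinder r (0 : ℝ × (EuclideanSpace ℝ (Fin 3))) =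
      stAffine β R T x₀ ⁻¹' (Ioo (T - (R * r) ^ 2 / ν) T ×ˢ ball x₀ (R * r)) := fun r => by
    rw [hβdef, stAffine_preimage_cylinder_eq_parabolicCylinder hν hRpos T x₀ (R * r),
      mul_div_cancel_left₀ r hRpos.ne']
    rfl
  set PO : Opens (ℝ × (EuclideanSpace ℝ (Fin 3))) := ⟨Ioo (T - β) T ×ˢ ball x₀ R, isOpen_Ioo.prod isOpen_ball⟩ with hPO
  have hPOsub : (PO : Set (ℝ × (EuclideanSpace ℝ (Fin 3)))) ⊆ Ioo (T / 2) T ×ˢ ball (0 : (EuclideanSpace ℝ (Fin 3))) ϱ := by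
    have := hνcyl 1 one_pos le_rfl
    rw [mul_one] at this
    exact this
  have hPOslab : (PO : Set (ℝ × (EuclideanSpace ℝ (Fin 3)))) ⊆ Ioo 0 T ×ˢ (univ : Set (EuclideanSpace ℝ (Fin 3))) := hPOsub.trans hhalf
  have hPOle : PO ≤ slab (EuclideanSpace ℝ (Fin 3)) (Ioo 0 T) isOpen_Ioo := fun z hz => hPOslab hz
  -- ### `Φ⁻¹(PO) = Q(0, 1)` and the rescaled pair
  have hpre1 : stPreimage β R T x₀ PO = parabolicCylinderOpens 1 (0 : ℝ × (EuclideanSpace ℝ (Fin 3))) := by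
    apply Opens.ext
    rw [coe_stPreimage]
    have h := stAffine_preimage_cylinder_eq_parabolicCylinder hν hRpos T x₀ R
    rw [div_self hRpos.ne'] at h
    exact h
  have hsuit1 : IsSuitableWeakSolutionOn (parabolicCylinderOpens 1 (0 : ℝ × (EuclideanSpace ℝ (Fin 3)))) 1 0
      (α • stPull β R T x₀ u) (α ^ 2 • stPull β R T x₀ p) := by
    have h0 := (hsw.of_le hPOle).stRescale hαpos hRpos hβeq T x₀
    have hvisc : α * ν / R = 1 := by
      rw [hα, div_mul_cancel₀ R hν.ne', div_self hRpos.ne']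
    have hforce : ((α ^ 2 * R) • stPull β R T x₀ (0 : ℝ → (EuclideanSpace ℝ (Fin 3)) → (EuclideanSpace ℝ (Fin 3)))) = 0 := by
      funext s y; simp [stPull]
    rw [hvisc, hforce, hpre1] at h0
    exact h0
  -- the rescaled classical gradient and its dissipation on `Q(0, r)`
  have hGu : HasWeakSpatialGradientOn PO u fun t x => fderiv ℝ (u t) x :=
    hasWeakSpatialGradientOn_of_contDiffOn isOpen_Ioo hPOslab (hsm.of_le (by norm_cast))
  have hGv : HasWeakSpatialGradientOn (parabolicCylinderOpens 1 (0 : ℝ × (EuclideanSpace ℝ (Fin 3))))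
      (α • stPull β R T x₀ u) ((α * R) • stPull β R T x₀ fun t x => fderiv ℝ (u t) x) := by
    rw [← hpre1]
    exact hGu.stRescale α hβpos hRpos T x₀
  have hEr : ∀ r : ℝ, 0 < r →
      ∫⁻ z in parabolicCylinder r (0 : ℝ × (EuclideanSpace ℝ (Fin 3))), ENNReal.ofReal (frobeniusNormSq
          (((α * R) • stPull β R T x₀ fun t x => fderiv ℝ (u t) x) z.1 z.2)) =
        ENNReal.ofReal ((α * R) ^ 2) * ENNReal.ofReal (β * R ^ 3)⁻¹ *
          ∫⁻ z in Ioo (T - (R * r) ^ 2 / ν) T ×ˢ ball x₀ (R * r),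
            ENNReal.ofReal (frobeniusNormSq (fderiv ℝ (u z.1) z.2)) := by
    intro r hr
    rw [hpreim r, setLIntegral_frobeniusNormSq_stRescale hβpos hRpos T x₀ (α * R),
      finrank_euclideanSpace_fin]
  -- ### `E(r) ≤ ν⁻¹ · (Hardy dissipation of the time tail)` for `0 < r < 1`
  have hcknE : ∀ r ∈ Ioo (0 : ℝ) 1,
      cknE r (0 : ℝ × (EuclideanSpace ℝ (Fin 3))) ((α * R) • stPull β R T x₀ fun t x => fderiv ℝ (u t) x) ≤
        ENNReal.ofReal ν⁻¹ * ∫⁻ z in Ioo (T - τ₀) T ×ˢ (univ : Set (EuclideanSpace ℝ (Fin 3))), F z := by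
    intro r hr
    have hr0 : 0 < r := hr.1
    have hRr : 0 < R * r := mul_pos hRpos hr0
    have hRrR : R * r ≤ R := mul_le_of_le_one_right hRpos.le hr.2.le
    have hτ : (R * r) ^ 2 / ν ≤ τ₀ :=
      le_trans (div_le_div_of_nonneg_right (pow_le_pow_left₀ hRr.le hRrR 2) hν.le) hRτ
    set cyl : Set (ℝ × (EuclideanSpace ℝ (Fin 3))) := Ioo (T - (R * r) ^ 2 / ν) T ×ˢ ball x₀ (R * r) with hcyl
    have hcylmeas : MeasurableSet cyl := measurableSet_Ioo.prod measurableSet_ball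
    -- Hardy domination on the cylinder: `|∇u|² ≤ (Rr) · |∇u|²/|x - x₀|`
    have hc0 : ENNReal.ofReal (R * r) ≠ 0 := (ENNReal.ofReal_pos.2 hRr).ne'
    have hctop : ENNReal.ofReal (R * r) ≠ ∞ := ENNReal.ofReal_ne_top
    have hdom : ∫⁻ z in cyl, ENNReal.ofReal (frobeniusNormSq (fderiv ℝ (u z.1) z.2)) ≤
        ENNReal.ofReal (R * r) * ∫⁻ z in cyl, F z := by
      have hpt : ∀ z ∈ cyl, ENNReal.ofReal (frobeniusNormSq (fderiv ℝ (u z.1) z.2)) ≤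
          ENNReal.ofReal (R * r) * F z := by
        intro z hz
        have hdist : ‖z.2 - x₀‖ₑ ≤ ENNReal.ofReal (R * r) := by
          rw [← ofReal_norm, ← dist_eq_norm]
          exact ENNReal.ofReal_le_ofReal (le_of_lt (mem_ball.1 (mem_prod.1 hz).2))
        rw [hF, indicator_of_mem (hνcylS r hr0 hr.2.le hz)]
        exact hardyEnergyBound_le_mul_div hdist hc0 hctop
      calc ∫⁻ z in cyl, ENNReal.ofReal (frobeniusNormSq (fderiv ℝ (u z.1) z.2))
          ≤ ∫⁻ z in cyl, ENNReal.ofReal (R * r) * F z := setLIntegral_mono' hcylmeas hpt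
        _ = ENNReal.ofReal (R * r) * ∫⁻ z in cyl, F z := lintegral_const_mul' _ _ hctop
    have hmono : ∫⁻ z in cyl, F z ≤ ∫⁻ z in Ioo (T - τ₀) T ×ˢ (univ : Set (EuclideanSpace ℝ (Fin 3))), F z :=
      lintegral_mono_set (prod_mono (Ioo_subset_Ioo_left (by linarith)) (subset_univ _))
    unfold cknE
    rw [hEr r hr0]
    have key : (ENNReal.ofReal r)⁻¹ * (ENNReal.ofReal ((α * R) ^ 2) * ENNReal.ofReal (β * R ^ 3)⁻¹ *
        (ENNReal.ofReal (R * r) * ∫⁻ z in Ioo (T - τ₀) T ×ˢ (univ : Set (EuclideanSpace ℝ (Fin 3))), F z)) =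
        ENNReal.ofReal ν⁻¹ * ∫⁻ z in Ioo (T - τ₀) T ×ˢ (univ : Set (EuclideanSpace ℝ (Fin 3))), F z := by
      rw [← ENNReal.ofReal_inv_of_pos hr0, ← mul_assoc, ← mul_assoc, ← mul_assoc,
        ← ENNReal.ofReal_mul (inv_nonneg.2 hr0.le),
        ← ENNReal.ofReal_mul (by positivity : (0 : ℝ) ≤ r⁻¹ * (α * R) ^ 2),
        ← ENNReal.ofReal_mul (by positivity : (0 : ℝ) ≤ r⁻¹ * (α * R) ^ 2 * (β * R ^ 3)⁻¹)]
      congr 2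
      rw [hα, hβdef]
      field_simp
    rw [← key]
    gcongr
    exact hdom.trans (mul_le_mul' le_rfl hmono)
  -- ### the rescaled pair in the class `IsSuitableWeakSolutionInBall 1 0`
  have hball : IsSuitableWeakSolutionInBall 1 0 (α • stPull β R T x₀ u)
      (α ^ 2 • stPull β R T x₀ p) := by
    refine ⟨hsuit1, ?_, ⟨_, hGv, ?_⟩, ?_⟩
    · -- energy class from the local energy bound on `(T/2, T) × B(0, ϱ)`
      have hphys : ∀ᵐ t ∂(volume.restrict (Ioo (T + β * (-1)) (T + β * 0))),
          ∫⁻ x in ball x₀ R, ‖u t x‖ₑ ^ 2 ≤ (C : ℝ≥0∞) := by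
        refine (ae_restrict_mem measurableSet_Ioo).mono fun t ht => ?_
        have hβT : β ≤ T / 2 := by
          have := hνcylT 1 one_pos le_rfl
          rw [mul_one] at this
          exact this
        have htI : t ∈ Ioo (T / 2) T := ⟨by linarith [ht.1], by simpa using ht.2⟩
        exact (lintegral_mono_set (hballϱ R hRρ₀)).trans (hC t htI)
      have h2 := ae_sliced_setLIntegral_ball_stRescale hβpos hRpos T x₀ x₀ R (-1) 0
        (fun t x => ‖u t x‖ₑ ^ 2) hphys
      rw [finrank_euclideanSpace_fin, sub_self, smul_zero, div_self hRpos.ne'] at h2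
      set C₁ : ℝ≥0∞ := ‖α‖ₑ ^ 2 * (ENNReal.ofReal (R ^ 3)⁻¹ * C) with hC₁
      have hC₁top : C₁ ≠ ∞ :=
        ENNReal.mul_ne_top (by simp) (ENNReal.mul_ne_top ENNReal.ofReal_ne_top ENNReal.coe_ne_top)
      refine ⟨C₁.toNNReal, ?_⟩
      rw [ENNReal.coe_toNNReal hC₁top]
      have hset : Ioo ((0 : ℝ × (EuclideanSpace ℝ (Fin 3))).1 - 1 ^ 2) (0 : ℝ × (EuclideanSpace ℝ (Fin 3))).1 = Ioo (-1 : ℝ) 0 := by simp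
      rw [hset]
      filter_upwards [h2] with s hs
      have e : ∀ y : (EuclideanSpace ℝ (Fin 3)), ‖(α • stPull β R T x₀ u) s y‖ₑ ^ 2 =
          ‖α‖ₑ ^ 2 * ‖u (T + β * s) (x₀ + R • y)‖ₑ ^ 2 := by
        intro y
        rw [smul_stPull_apply, enorm_smul, mul_pow]
      simp only [e]
      rw [lintegral_const_mul' _ _ (by simp)]
      exact mul_le_mul' le_rfl hs
    · -- `∫_{Q(0,1)} |∇v|² < ∞`
      rw [hEr 1 one_pos]
      refine ENNReal.mul_lt_top (ENNReal.mul_lt_top ENNReal.ofReal_lt_top ENNReal.ofReal_lt_top) ?_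
      exact lt_of_le_of_lt (lintegral_mono_set (hνcyl 1 one_pos le_rfl)) hE
    · -- `π ∈ L^{3/2}(Q(0,1))`
      refine ⟨hsuit1.distributional.2.2.1.aestronglyMeasurable, ?_⟩
      have h32 : ((3 : ℝ≥0∞) / 2).toReal = 3 / 2 := by
        rw [ENNReal.toReal_div]; norm_num
      have h32top : (3 : ℝ≥0∞) / 2 ≠ ∞ := (ENNReal.div_lt_top (by simp) (by simp)).ne
      rw [eLpNorm_eq_lintegral_rpow_enorm_toReal (by norm_num) h32top, h32]
      refine ENNReal.rpow_lt_top_of_nonneg (by positivity) (ne_of_lt ?_)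
      have hQ1 : parabolicCylinder 1 (0 : ℝ × (EuclideanSpace ℝ (Fin 3))) = stAffine β R T x₀ ⁻¹' (PO : Set (ℝ × (EuclideanSpace ℝ (Fin 3)))) := by
        rw [← coe_stPreimage, hpre1]; rfl
      rw [hQ1]
      show ∫⁻ z in stAffine β R T x₀ ⁻¹' (PO : Set (ℝ × (EuclideanSpace ℝ (Fin 3)))),
          ‖(α ^ 2 • stPull β R T x₀ p) z.1 z.2‖ₑ ^ (3 / 2 : ℝ) < ∞
      rw [setLIntegral_enorm_rpow_stRescale hβpos hRpos T x₀ (α ^ 2) p _ (by norm_num)]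
      refine ENNReal.mul_lt_top (ENNReal.mul_lt_top
        (ENNReal.rpow_lt_top_of_nonneg (by norm_num) enorm_ne_top) ENNReal.ofReal_lt_top) ?_
      exact lt_of_le_of_lt (lintegral_mono_set hPOsub) hP
  -- ### smallness of the multi-scale dissipation and Seregin's criterion
  have hsmall : (⨆ r ∈ Ioo (0 : ℝ) 1,
      cknE r (0 : ℝ × (EuclideanSpace ℝ (Fin 3))) ((α * R) • stPull β R T x₀ fun t x => fderiv ℝ (u t) x)) <
        ENNReal.ofReal ε := by
    refine lt_of_le_of_lt (iSup₂_le fun r hr => hcknE r hr) ?_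
    have hc0 : ENNReal.ofReal ν⁻¹ ≠ 0 := (ENNReal.ofReal_pos.2 (by positivity)).ne'
    calc ENNReal.ofReal ν⁻¹ * ∫⁻ z in Ioo (T - τ₀) T ×ˢ (univ : Set (EuclideanSpace ℝ (Fin 3))), F z
        < ENNReal.ofReal ν⁻¹ * ENNReal.ofReal (ε * ν) := by
          have := ENNReal.mul_lt_mul_left hc0 ENNReal.ofReal_ne_top hDτ₀
          simpa only [mul_comm] using this
      _ = ENNReal.ofReal ε := by
          rw [← ENNReal.ofReal_mul (by positivity)]
          congr 1
          field_simp
  obtain ⟨ϱ', hϱ', hbd⟩ := hcrit _ _ hball ⟨_, hGv, hsmall⟩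
  -- ### back to `u`: `Q(0, ϱ') = Φ⁻¹((T - (Rϱ')²/ν, T) × B(x₀, Rϱ'))`, essential suprema are
  -- `Φ`-invariant, and an essential bound of the continuous `u` below `T` is a bound
  rw [hpreim ϱ', show uncurry (α • stPull β R T x₀ u) = α • (uncurry u ∘ stAffine β R T x₀) from
    rfl, eLpNorm_const_smul, eLpNorm_top_comp_stAffine_restrict_preimage hβpos hRpos] at hbd
  exact isBoundedNearTop_of_eLpNorm_cylinder_lt_top hsm.continuousOn
    (div_pos (pow_pos (mul_pos hRpos hϱ'.1) 2) hν)
    ((hνcylT ϱ' hϱ'.1 hϱ'.2.le).trans (by linarith)) (mul_pos hRpos hϱ'.1)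
    (ENNReal.lt_top_of_mul_ne_top_right hbd.ne (by simp [hαpos.ne']))

/-- **Contrapositive — where the final time is singular, the Hardy dissipation at the centre is
infinite on every box.**  In the frame of `isBoundedNearTop_of_hardyDissipation_lt_top`, if `u` is
NOT bounded near `(T, x₀)` then `∫∫_{(T−δ,T)×B(x₀,ρ₀)} |∇u|²/|x − x₀| = ∞` for all `δ, ρ₀ > 0`:
the dissipative side of the point-sink ledger diverges at every singular point ("a singularity
must drink divergent head", dissipative half). [cite: Seregin2014, Ch. 6 §6.1 Theorem 1.4, PDF p. 94] -/
theorem hardyDissipation_eq_top_of_not_isBoundedNearTop {ν T : ℝ} (hν : 0 < ν) (hT : 0 < T)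
    {u : ℝ → (EuclideanSpace ℝ (Fin 3)) → (EuclideanSpace ℝ (Fin 3))} {p : ℝ → (EuclideanSpace ℝ (Fin 3)) → ℝ} (hsm : ContDiffOn ℝ (⊤ : ℕ∞) (uncurry u) (Ioo 0 T ×ˢ univ))
    (hsw : IsSuitableWeakSolutionOn (slab (EuclideanSpace ℝ (Fin 3)) (Ioo 0 T) isOpen_Ioo) ν 0 u p)
    (hloc : ∀ t₁ ∈ Ioo 0 T, ∀ ρ : ℝ, 0 < ρ →
      (∃ C : ℝ≥0, ∀ t ∈ Ioo t₁ T, ∫⁻ x in ball (0 : (EuclideanSpace ℝ (Fin 3))) ρ, ‖u t x‖ₑ ^ 2 ≤ C) ∧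
      (∫⁻ z in Ioo t₁ T ×ˢ ball (0 : (EuclideanSpace ℝ (Fin 3))) ρ,
          ENNReal.ofReal (frobeniusNormSq (fderiv ℝ (u z.1) z.2)) < ∞) ∧
      (∫⁻ z in Ioo t₁ T ×ˢ ball (0 : (EuclideanSpace ℝ (Fin 3))) ρ, ‖p z.1 z.2‖ₑ ^ (3 / 2 : ℝ) < ∞))
    {x₀ : (EuclideanSpace ℝ (Fin 3))} (hsing : ¬ IsBoundedNearTop u T x₀) {δ ρ₀ : ℝ} (hδ : 0 < δ) (hρ₀ : 0 < ρ₀) :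
    ∫⁻ z in Ioo (T - δ) T ×ˢ ball x₀ ρ₀,
      ENNReal.ofReal (frobeniusNormSq (fderiv ℝ (u z.1) z.2)) / ‖z.2 - x₀‖ₑ = ∞ := by
  by_contra hfin
  exact hsing (isBoundedNearTop_of_hardyDissipation_lt_top hν hT hsm hsw hloc x₀ hδ hρ₀
    (lt_top_iff_ne_top.2 hfin))

/-! ### Registered anchor (pure `∀` form, fully qualified) -/

/-- **Anchor `hardyEnergyBound_hardyDissipation_eq_top` (lead c6, `--supports
stmt-NavierStokesRegularity-7979`).**  For a suitable weak solution `(u, p)` (viscosity `ν > 0`) on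
the strip `(0, T) × ℝ³`, `u` smooth inside, local energy classes reaching the final time, and a
centre `x₀` at which `u` is NOT bounded near `(T, x₀)`: the Hardy dissipation at the centre is
infinite on every box, `∫∫_{(T−δ,T)×B(x₀,ρ₀)} |∇u|²/|x − x₀| = ∞`
(`hardyDissipation_eq_top_of_not_isBoundedNearTop`). [cite: Seregin2014, Ch. 6 §6.1 Theorem 1.4, PDF p. 94] -/
theorem hardyEnergyBound_hardyDissipation_eq_top :
    ∀ ν : ℝ, 0 < ν → ∀ T : ℝ, 0 < T →
      ∀ (u : ℝ → EuclideanSpace ℝ (Fin 3) → EuclideanSpace ℝ (Fin 3))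
        (p : ℝ → EuclideanSpace ℝ (Fin 3) → ℝ),
      ContDiffOn ℝ (⊤ : ℕ∞) (Function.uncurry u) (Set.Ioo 0 T ×ˢ Set.univ) →
      Literature.Analysis.FluidPDE.IsSuitableWeakSolutionOn
        (Literature.Analysis.FluidPDE.slab (EuclideanSpace ℝ (Fin 3)) (Set.Ioo 0 T) isOpen_Ioo)
        ν 0 u p →
      (∀ t₁ ∈ Set.Ioo 0 T, ∀ ρ : ℝ, 0 < ρ →
          (∃ C : NNReal, ∀ t ∈ Set.Ioo t₁ T,
              ∫⁻ x in Metric.ball (0 : EuclideanSpace ℝ (Fin 3)) ρ, ‖u t x‖ₑ ^ 2 ≤ C) ∧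
          (∫⁻ z in Set.Ioo t₁ T ×ˢ Metric.ball (0 : EuclideanSpace ℝ (Fin 3)) ρ,
              ENNReal.ofReal (Literature.Analysis.FluidPDE.frobeniusNormSq (fderiv ℝ (u z.1) z.2)) < ⊤) ∧
          (∫⁻ z in Set.Ioo t₁ T ×ˢ Metric.ball (0 : EuclideanSpace ℝ (Fin 3)) ρ,
              ‖p z.1 z.2‖ₑ ^ (3 / 2 : ℝ) < ⊤)) →
      ∀ x₀ : EuclideanSpace ℝ (Fin 3),
        ¬ Literature.Analysis.FluidPDE.IsBoundedNearTop u T x₀ →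
        ∀ δ ρ₀ : ℝ, 0 < δ → 0 < ρ₀ →
          ∫⁻ z in Set.Ioo (T - δ) T ×ˢ Metric.ball x₀ ρ₀,
              ENNReal.ofReal (Literature.Analysis.FluidPDE.frobeniusNormSq (fderiv ℝ (u z.1) z.2))
                / ‖z.2 - x₀‖ₑ = ⊤ :=
  fun _ν hν _T hT _u _p hsm hsw hloc _x₀ hsing _δ _ρ₀ hδ hρ₀ =>
    hardyDissipation_eq_top_of_not_isBoundedNearTop hν hT hsm hsw hloc hsing hδ hρ₀

end Summit.NavierStokesRegularity.NavierStokesRegularity.Theorems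

end
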